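import Summits.CriticalPhenomena.PercolationContinuityZ3.Theorems.Transplant.SkelRootChainW
import Summits.CriticalPhenomena.PercolationContinuityZ3.Theorems.Transplant.SkelPhiWinChainF3
import HarnessLib

/-!
# N1 (the `{±1}` node), (R) column (NEG-SCOPE B.17, y′-family v3): THE ROOT RESIDUE `Skel.RootOblTWAt` OF AN ARBITRARY ANCHORED SCHEME FROM A THREE-WINDOW CHAIN
# UNDER THE ROOT-SEED LAW — **`Skel.rootOblTWAt_of_chain₃`**, the verbatim three-segment twin of `rootOblTWAt_of_chain₂` (SkelRootChainW, p287070): frames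
# `S₁` (bridge), `S₂` (x-run prefix), `S₃` (y′-run) read through planar windows `𝒲₁ 𝒲₂ 𝒲₃` of the root's ball window graph, glued by `WinChainData.chain₃`

WHY (located (L-R4), lane INBOX 2026-08-21T19:47Z): for a vertical direction the y′-run's first link regions would contain the pinned seed; the x-run prefix moves
the chain `≈ 4 n_L` sideways first.

builds on p205010 (kernel theorem, internal audit signed; external expert review pending) — nothing in this file uses p205010; nothing here is a claim about the open node.
Lane `prim-bschramm`, seat `prim-bschramm-p3` (gen 10; design owner + (R) owner); helper file (`--supports stmt-CriticalPhenomena-4575 --as helper`).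
[cite: KozmaNitzan2024, §4 p. 27 (G₀), p. 28 ((32) at the root), Lemma 11 (pp. 22–23), Lemma 12 (pp. 23–25)]
-/

noncomputable section

open MeasureTheory ProbabilityTheory
open scoped ENNReal Classical

namespace Summit.CriticalPhenomena.PercolationContinuityZ3.Theorems

namespace Transplant

namespace Skel

open Literature.Probability.Percolation Literature.Probability.LatticeModels SimpleGraph GadgetSystem ProbeHistory HSiteScheme Contour KNCells
open KNCells.KSchA KNLevels ChainPlanar
open Literature.Barriers.CriticalPhenomena (graphBall mem_graphBall_self)

variable {V : Type} [DecidableEq V] [Countable V] {G : SimpleGraph V} [G.LocallyFinite] {A' : Type*}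

/-! ## The assembly from a three-window chain under the root-seed law -/

/-- **THE ROOT RESIDUE AT ONE DIRECTION FROM A THREE-WINDOW CHAIN UNDER THE ROOT-SEED LAW** (scheme-generic, window-generic; NEG-SCOPE B.17, the y′-family v3:
bridge → x-run prefix → y′-run).  As `rootOblTWAt_of_chain₂` with a third frame `S₃` / window `𝒲₃` / chain data `P₃`, the second cross link
`𝒲₂.coreTF S₂ S₂.N ⊆ 𝒲₃.W (S₃.core 0)`, accuracy `δr n` with `n := S₁.N + 1 + S₂.N + 1 + S₃.N`, and the last true target of segment 3 inside `M_{a₀}(0 + du)`.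
[cite: KozmaNitzan2024, §4 p. 28 ((32) at the root), Lemma 11 (pp. 22–23), Lemma 12 (pp. 23–25)] -/
theorem rootOblTWAt_of_chain₃ {S : KSchA V A'} {du : MDir} {Rπ : ℕ}
    -- the pinned seed (inside the root cube and the ball, containing the root, internally connected)
    {A : Finset V} (hAQ : A ⊆ S.Γ.Q S.Γ.a₀ 0) (hAπ : ∀ a ∈ A, a ∈ graphBall G S.Γ.root Rπ) (htA : S.Γ.root ∈ A)
    (hAconn : ∀ a ∈ A, PathIn G (↑A : Set V) S.Γ.root a)
    -- three windows of the root's ball window graph, three frames, chain data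
    (𝒲₁ 𝒲₂ 𝒲₃ : Skelφ.PlanarWindow (winGraph G S.Γ.root Rπ)) (S₁ S₂ S₃ : SchedFrame) (P₁ P₂ P₃ : Skelφ.WinChainData V)
    (hPo₁ : P₁.o = S.Γ.root) (hPo₂ : P₂.o = S.Γ.root) (hPo₃ : P₃.o = S.Γ.root)
    (hPS₁ : P₁.Sfin = (S.U0root du).filter fun y => y ∈ graphBall G S.Γ.root Rπ)
    (hPS₂ : P₂.Sfin = (S.U0root du).filter fun y => y ∈ graphBall G S.Γ.root Rπ)
    (hPS₃ : P₃.Sfin = (S.U0root du).filter fun y => y ∈ graphBall G S.Γ.root Rπ)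
    (hRim₁ : ∀ k, P₁.Rim k ⊆ 𝒲₁.stepDF S₁ k) (hRim₂ : ∀ k, P₂.Rim k ⊆ 𝒲₂.stepDF S₂ k) (hRim₃ : ∀ k, P₃.Rim k ⊆ 𝒲₃.stepDF S₃ k)
    (hRl₁ : P₁.Rlev + 1 ≤ S₁.R') (hRl₂ : P₂.Rlev + 1 ≤ S₂.R') (hRl₃ : P₃.Rlev + 1 ≤ S₃.R')
    (hj₁ : P₁.j₁ ≤ P₁.Rlev) (hj₂ : P₂.j₁ ≤ P₂.Rlev) (hj₃ : P₃.j₁ ≤ P₃.Rlev)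
    (hTne₁ : ∀ k ≤ S₁.N, (𝒲₁.coreTF S₁ k).Nonempty) (hTne₂ : ∀ k ≤ S₂.N, (𝒲₂.coreTF S₂ k).Nonempty) (hTne₃ : ∀ k ≤ S₃.N, (𝒲₃.coreTF S₃ k).Nonempty)
    -- the rooms: regions inside the cut root world, off the pinned seed; the two cross links; the last core inside `M_{a₀}(0+du)`
    (hDU₁ : ∀ k ≤ S₁.N, 𝒲₁.stepDF S₁ k ⊆ (S.U0root du).filter fun y => y ∈ graphBall G S.Γ.root Rπ)
    (hDU₂ : ∀ k ≤ S₂.N, 𝒲₂.stepDF S₂ k ⊆ (S.U0root du).filter fun y => y ∈ graphBall G S.Γ.root Rπ)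
    (hDU₃ : ∀ k ≤ S₃.N, 𝒲₃.stepDF S₃ k ⊆ (S.U0root du).filter fun y => y ∈ graphBall G S.Γ.root Rπ)
    (hDA₁ : ∀ k ≤ S₁.N, Disjoint (𝒲₁.stepDF S₁ k) A) (hDA₂ : ∀ k ≤ S₂.N, Disjoint (𝒲₂.stepDF S₂ k) A) (hDA₃ : ∀ k ≤ S₃.N, Disjoint (𝒲₃.stepDF S₃ k) A)
    (hx₁₂ : 𝒲₁.coreTF S₁ S₁.N ⊆ 𝒲₂.W (S₂.core 0)) (hx₂₃ : 𝒲₂.coreTF S₂ S₂.N ⊆ 𝒲₃.W (S₃.core 0))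
    (hlast : 𝒲₃.coreTF S₃ S₃.N ⊆ S.Γ.M S.Γ.a₀ ((0 : Site 2) + stepVec du))
    -- the hop: ONE link input valid for `P_q`, prism inside the world, target inside the first level
    {Δ' : ℕ} {δr : ℕ → ℝ} {η : ℝ} {Qp T₀ : Finset V}
    (hlink : 1 - δr (S₁.N + 1 + S₂.N + 1 + S₃.N) < (bondPercolation G S.p).real (linkIn (↑Qp : Set V) A T₀))
    (hQU : Qp ⊆ (S.U0root du).filter fun y => y ∈ graphBall G S.Γ.root Rπ) (hT₀ : T₀ ⊆ 𝒲₁.W (S₁.core 0))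
    -- analytic inputs under the root-seed law, accuracy `δr n`
    (hcount₁ : 1 / (1 - (S.p : ℝ)) ^ (Δ' * P₁.N) ≤ δr (S₁.N + 1 + S₂.N + 1 + S₃.N) * ((Finset.Icc P₁.j₀ P₁.j₁).card : ℝ))
    (hcount₂ : 1 / (1 - (S.p : ℝ)) ^ (Δ' * P₂.N) ≤ δr (S₁.N + 1 + S₂.N + 1 + S₃.N) * ((Finset.Icc P₂.j₀ P₂.j₁).card : ℝ))
    (hcount₃ : 1 / (1 - (S.p : ℝ)) ^ (Δ' * P₃.N) ≤ δr (S₁.N + 1 + S₂.N + 1 + S₃.N) * ((Finset.Icc P₃.j₀ P₃.j₁).card : ℝ))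
    (hkits₁ : ∀ k ≤ S₁.N, ∀ j ∈ Finset.Icc P₁.j₀ P₁.j₁, ∃ (σ : SData V) (Sz : Finset V),
      SHyp (P₁.stepLF 𝒲₁ S₁ k) j σ ∧ σ.N ≤ P₁.N ∧
      (1 - (S.p : ℝ) ^ σ.sB) ^ σ.k ≤ δr (S₁.N + 1 + S₂.N + 1 + S₃.N) ∧ Sz ⊆ (P₁.stepLF 𝒲₁ S₁ k).X j ∧ Sz ⊆ 𝒲₁.stepDF S₁ k ∧
      (∀ x ∈ σ.K, ∀ e' ∈ σ.seed x, e' ∉ wireSet (↑Sz : Set V)) ∧ (∀ x ∈ σ.K, σ.face x ⊆ Sz) ∧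
      (∀ x ∈ σ.K, 1 - 3 * δr (S₁.N + 1 + S₂.N + 1 + S₃.N) ≤ (prodBernoulli (S.W0pin G (edgesIn G A) ((S.U0root du).filter fun y => y ∈ graphBall G S.Γ.root Rπ))).real
        {ω | ∃ u ∈ σ.face x, 1 - δr (S₁.N + 1 + S₂.N + 1 + S₃.N) <
          (prodBernoulli (pinW (S.W0pin G (edgesIn G A) ((S.U0root du).filter fun y => y ∈ graphBall G S.Γ.root Rπ)) (wireSet (↑Sz : Set V)) ω)).real
            (⋃ t' ∈ P₁.coreEF 𝒲₁ S₁ k, openConnIn (↑(𝒲₁.stepDF S₁ k) : Set V) u t')}))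
    (hkits₂ : ∀ k ≤ S₂.N, ∀ j ∈ Finset.Icc P₂.j₀ P₂.j₁, ∃ (σ : SData V) (Sz : Finset V),
      SHyp (P₂.stepLF 𝒲₂ S₂ k) j σ ∧ σ.N ≤ P₂.N ∧
      (1 - (S.p : ℝ) ^ σ.sB) ^ σ.k ≤ δr (S₁.N + 1 + S₂.N + 1 + S₃.N) ∧ Sz ⊆ (P₂.stepLF 𝒲₂ S₂ k).X j ∧ Sz ⊆ 𝒲₂.stepDF S₂ k ∧
      (∀ x ∈ σ.K, ∀ e' ∈ σ.seed x, e' ∉ wireSet (↑Sz : Set V)) ∧ (∀ x ∈ σ.K, σ.face x ⊆ Sz) ∧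
      (∀ x ∈ σ.K, 1 - 3 * δr (S₁.N + 1 + S₂.N + 1 + S₃.N) ≤ (prodBernoulli (S.W0pin G (edgesIn G A) ((S.U0root du).filter fun y => y ∈ graphBall G S.Γ.root Rπ))).real
        {ω | ∃ u ∈ σ.face x, 1 - δr (S₁.N + 1 + S₂.N + 1 + S₃.N) <
          (prodBernoulli (pinW (S.W0pin G (edgesIn G A) ((S.U0root du).filter fun y => y ∈ graphBall G S.Γ.root Rπ)) (wireSet (↑Sz : Set V)) ω)).real
            (⋃ t' ∈ P₂.coreEF 𝒲₂ S₂ k, openConnIn (↑(𝒲₂.stepDF S₂ k) : Set V) u t')}))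
    (hkits₃ : ∀ k ≤ S₃.N, ∀ j ∈ Finset.Icc P₃.j₀ P₃.j₁, ∃ (σ : SData V) (Sz : Finset V),
      SHyp (P₃.stepLF 𝒲₃ S₃ k) j σ ∧ σ.N ≤ P₃.N ∧
      (1 - (S.p : ℝ) ^ σ.sB) ^ σ.k ≤ δr (S₁.N + 1 + S₂.N + 1 + S₃.N) ∧ Sz ⊆ (P₃.stepLF 𝒲₃ S₃ k).X j ∧ Sz ⊆ 𝒲₃.stepDF S₃ k ∧
      (∀ x ∈ σ.K, ∀ e' ∈ σ.seed x, e' ∉ wireSet (↑Sz : Set V)) ∧ (∀ x ∈ σ.K, σ.face x ⊆ Sz) ∧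
      (∀ x ∈ σ.K, 1 - 3 * δr (S₁.N + 1 + S₂.N + 1 + S₃.N) ≤ (prodBernoulli (S.W0pin G (edgesIn G A) ((S.U0root du).filter fun y => y ∈ graphBall G S.Γ.root Rπ))).real
        {ω | ∃ u ∈ σ.face x, 1 - δr (S₁.N + 1 + S₂.N + 1 + S₃.N) <
          (prodBernoulli (pinW (S.W0pin G (edgesIn G A) ((S.U0root du).filter fun y => y ∈ graphBall G S.Γ.root Rπ)) (wireSet (↑Sz : Set V)) ω)).real
            (⋃ t' ∈ P₃.coreEF 𝒲₃ S₃ k, openConnIn (↑(𝒲₃.stepDF S₃ k) : Set V) u t')}))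
    (hη : η ≤ δr (S₁.N + 1 + S₂.N + 1 + S₃.N) / 2)
    (hexc₁ : ∀ k ≤ S₁.N, (prodBernoulli (S.W0pin G (edgesIn G A) ((S.U0root du).filter fun y => y ∈ graphBall G S.Γ.root Rπ))).real
      (⋃ t' ∈ P₁.Rim k, openConn S.Γ.root t') ≤ η)
    (hexc₂ : ∀ k ≤ S₂.N, (prodBernoulli (S.W0pin G (edgesIn G A) ((S.U0root du).filter fun y => y ∈ graphBall G S.Γ.root Rπ))).real
      (⋃ t' ∈ P₂.Rim k, openConn S.Γ.root t') ≤ η)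
    (hexc₃ : ∀ k ≤ S₃.N, (prodBernoulli (S.W0pin G (edgesIn G A) ((S.U0root du).filter fun y => y ∈ graphBall G S.Γ.root Rπ))).real
      (⋃ t' ∈ P₃.Rim k, openConn S.Γ.root t') ≤ η) :
    RootOblTWAt G S Δ' δr du := by
  set U' : Finset V := (S.U0root du).filter fun y => y ∈ graphBall G S.Γ.root Rπ with hU'
  set F : Finset (Sym2 V) := edgesIn G A with hF
  set W : Sym2 V → unitInterval := S.W0pin G F U' with hW
  set n : ℕ := S₁.N + 1 + S₂.N + 1 + S₃.N with hn
  -- the seed: its pairs are cube edges, its vertices lie in the cut world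
  have hFA : ∀ e ∈ F, ∀ w ∈ e, w ∈ A := fun e he w hw => ((mem_edgesIn_iff).1 he).2 w hw
  have hFU₀ : F ⊆ S.U₀ G := by
    intro e he
    rw [KSchA.U₀, mem_edgesIn_iff]
    obtain ⟨heG, heA⟩ := (mem_edgesIn_iff).1 he
    exact ⟨heG, fun x hx => hAQ (heA x hx)⟩
  have hAU : A ⊆ U' := fun a ha => Finset.mem_filter.2 ⟨Finset.mem_union_left _ (hAQ ha), hAπ a ha⟩
  have hrootU : S.Γ.root ∈ U' := hAU htA
  have hU'sub : U' ⊆ S.U0root du := Finset.filter_subset _ _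
  -- subbox regions (off the seed), the source off the regions
  have hfresh : ∀ {Dd : Finset V}, Disjoint Dd A → ∀ u ∈ Dd, ∀ z, s(u, z) ∉ F := fun hdis => KSchA.fresh_of_disjoint hFA hdis
  have hsub₁ : ∀ k ≤ S₁.N, IsSubbox (winGraph G S.Γ.root Rπ) W S.p (𝒲₁.stepDF S₁ k) :=
    fun k hk => isSubbox_W0pin_win (S := S) S.Γ.root Rπ (U := S.U0root du) (hDU₁ k hk) (hfresh (hDA₁ k hk))
  have hsub₂ : ∀ k ≤ S₂.N, IsSubbox (winGraph G S.Γ.root Rπ) W S.p (𝒲₂.stepDF S₂ k) :=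
    fun k hk => isSubbox_W0pin_win (S := S) S.Γ.root Rπ (U := S.U0root du) (hDU₂ k hk) (hfresh (hDA₂ k hk))
  have hsub₃ : ∀ k ≤ S₃.N, IsSubbox (winGraph G S.Γ.root Rπ) W S.p (𝒲₃.stepDF S₃ k) :=
    fun k hk => isSubbox_W0pin_win (S := S) S.Γ.root Rπ (U := S.U0root du) (hDU₃ k hk) (hfresh (hDA₃ k hk))
  have ho₁ : ∀ k ≤ S₁.N, P₁.o ∉ 𝒲₁.stepDF S₁ k := fun k hk h' => by
    rw [hPo₁] at h'; exact Finset.disjoint_left.1 (hDA₁ k hk) h' htA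
  have ho₂ : ∀ k ≤ S₂.N, P₂.o ∉ 𝒲₂.stepDF S₂ k := fun k hk h' => by
    rw [hPo₂] at h'; exact Finset.disjoint_left.1 (hDA₂ k hk) h' htA
  have ho₃ : ∀ k ≤ S₃.N, P₃.o ∉ 𝒲₃.stepDF S₃ k := fun k hk h' => by
    rw [hPo₃] at h'; exact Finset.disjoint_left.1 (hDA₃ k hk) h' htA
  -- the three-window chain
  have hC := Skelφ.WinChainData.chain₃ P₁ P₂ P₃ 𝒲₁ 𝒲₂ 𝒲₃ S₁ S₂ S₃ (hPo₂.trans hPo₁.symm) (hPo₃.trans hPo₁.symm)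
    hRl₁ hRim₁ hTne₁ hRl₂ hRim₂ hTne₂ hRl₃ hRim₃ hTne₃ hx₁₂ hx₂₃
    (p := S.p) (W' := W) (Δ' := Δ') (δ := δr n) (η := η)
    hsub₁ (by rw [hPS₁]; exact KSchA.finSupp_W0pin) (fun k hk => by rw [hPS₁]; exact hDU₁ k hk) ho₁ (by rw [hPo₁, hPS₁]; exact hrootU) hj₁
    hcount₁ hkits₁ (fun k hk => by rw [hPo₁]; exact hexc₁ k hk)
    hsub₂ (by rw [hPS₂]; exact KSchA.finSupp_W0pin) (fun k hk => by rw [hPS₂]; exact hDU₂ k hk) ho₂ (by rw [hPo₂, hPS₂]; exact hrootU) hj₂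
    hcount₂ hkits₂ (fun k hk => by rw [hPo₁]; exact hexc₂ k hk)
    hsub₃ (by rw [hPS₃]; exact KSchA.finSupp_W0pin) (fun k hk => by rw [hPS₃]; exact hDU₃ k hk) ho₃ (by rw [hPo₃, hPS₃]; exact hrootU) hj₃
    hcount₃ hkits₃ (fun k hk => by rw [hPo₁]; exact hexc₃ k hk)
  obtain ⟨ho, hlinkC, hsubC, hkitsC, hexcC, h0, hlastC⟩ := hC
  -- the hop under the root-seed law
  have hwired : ∀ u ∈ A, ∀ u' ∈ A, G.Adj u u' → s(u, u') ∈ F := fun u hu u' hu' hadj =>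
    (mem_edgesIn_iff).2 ⟨(SimpleGraph.mem_edgeSet G).2 hadj, fun x hx => by
      rcases Sym2.mem_iff.1 hx with rfl | rfl
      · exact hu
      · exact hu'⟩
  have hsrc : 1 - δr n < (prodBernoulli W).real (⋃ t' ∈ T₀, openConn S.Γ.root t') :=
    root_hsrc_of_pinned (S := S) hlink hQU hAU subset_rfl hAconn hwired
  refine ⟨n, S.Γ.root, Rπ, W, fun i => Skelφ.WinChainData.stepAF₃ P₁ P₂ P₃ 𝒲₁ 𝒲₂ 𝒲₃ S₁ S₂ S₃ i,
    fun i => Skelφ.WinChainData.coreTF₃ 𝒲₁ 𝒲₂ 𝒲₃ S₁ S₂ S₃ i, η,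
    fun T => KSchA.real_W0pin_le_rootLaw hFU₀ hU'sub hrootU T, fun i => (ho i).trans hPo₁, hlinkC, hsubC, hkitsC, hη,
    fun i => by have h := hexcC i; rw [hPo₁] at h; exact h, ?_, ?_⟩
  · -- the source bound: `T₀ ⊆ X^{(0)}_0 = 𝒲₁.W (S₁.core 0)`
    refine hsrc.trans_le (measureReal_mono ?_ (measure_ne_top _ _))
    intro ω hω
    simp only [Set.mem_iUnion, exists_prop] at hω
    obtain ⟨t', ht', hωt⟩ := hω
    have ht'' : t' ∈ (Skelφ.WinChainData.stepAF₃ P₁ P₂ P₃ 𝒲₁ 𝒲₂ 𝒲₃ S₁ S₂ S₃ ((0 : Fin (n + 1)) : ℕ)).L.X 0 := by rw [h0]; exact hT₀ ht'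
    have hoo : (Skelφ.WinChainData.stepAF₃ P₁ P₂ P₃ 𝒲₁ 𝒲₂ 𝒲₃ S₁ S₂ S₃ ((0 : Fin (n + 1)) : ℕ)).L.o = S.Γ.root := (ho 0).trans hPo₁
    show ω ∈ (Skelφ.WinChainData.stepAF₃ P₁ P₂ P₃ 𝒲₁ 𝒲₂ 𝒲₃ S₁ S₂ S₃ ((0 : Fin (n + 1)) : ℕ)).L.reachB
    rw [LData.reachB, hoo]
    exact Set.mem_biUnion (Finset.mem_coe.2 ht'') hωt
  · -- the last true target enters `M_{a₀}(0 + du)`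
    rw [hlastC]; exact hlast

end Skel

end Transplant

end Summit.CriticalPhenomena.PercolationContinuityZ3.Theorems

end
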